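import Summits.AtomisticToContinuum.BoseEinsteinCondensation.Theses.BECHardSphereReduction
import Summits.AtomisticToContinuum.BoseEinsteinCondensation.Theorems.BECCutLineWeakDisorderFlatModeFromLandscape

/-!
# BECHardSphereReduction / HardSphereZeroMode — the constant-mode occupation as a slice functional

Route `route-AtomisticToContinuum-BECHardSphereReduction`, support item `HardSphereZeroMode`
(stmt-AtomisticToContinuum-11888). Its informal statement reads the occupation of the normalised
constant mode `φ₀ = L^{-3/2}·1_{Λ_L}` in an `N = n+1`-body Dirichlet trial state `Ψ` as an average
delocalisation ratio of the one-particle slices `u_Y = Ψ(·, Y)`, `Y ∈ (ℝ³)ⁿ`: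
`⟨φ₀, γ_Ψ φ₀⟩ = N · L⁻³ ∫ |∫ u_Y|² dY` while `∫ (∫ |u_Y|²) dY = 1`. This file proves that reading
and the resulting criterion, for every Dirichlet trial state (no positivity needed):

* (reused from `BECCutLineWeakDisorderFlatModeFromLandscape`: `conj φ₀(x) · Ψ(x, Y) = L^{-3/2} Ψ(x, Y)`
  for every `x` — the Dirichlet condition kills the slice off the box);
* `occupation_constMode_eq_slices` — `⟨φ₀, γ_Ψ φ₀⟩ = N · L⁻³ · ∫ ‖∫ Ψ(x, Y) dx‖² dY`;
* `mul_le_occupation_constMode_of_slices` — **slice delocalisation on a set of configurations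
  carrying mass `m` gives occupation `≥ N c m`**: if `c L³ ∫|u_Y|² ≤ |∫ u_Y|²` for `Y` in a
  measurable `G` and `∫_G ∫ |u_Y|² ≥ m`, then `N (c m) ≤ ⟨φ₀, γ_Ψ φ₀⟩`;
* `hardSphereZeroMode_of_meanSliceDelocalisation`, `hardSphereZeroMode_of_goodConfigurations` —
  the item REDUCED to (i) mean slice delocalisation `∫ ‖∫ u_Y‖² dY ≥ c L³` of the near-minimisers,
  resp. (ii) slice delocalisation on a measurable set of configurations of the other particles
  carrying a fixed fraction of the mass (the form the taboo-process picture addresses).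
-/

noncomputable section

namespace Summit.AtomisticToContinuum.BoseEinsteinCondensation.Theorems

open MeasureTheory ENNReal Literature.MathematicalPhysics.QuantumManyBody.BoseGas
open scoped ComplexConjugate

variable {n : ℕ} {L : ℝ}

/-- `‖L^{-3/2}‖² = L⁻³` in `ℝ≥0∞`, for `L > 0`. [folklore] -/
theorem nnnorm_constMode_sq (hL : 0 < L) :
    ((‖((Real.sqrt (L ^ 3))⁻¹ : ℂ)‖₊ : ℝ≥0∞) ^ 2) = ENNReal.ofReal ((L ^ 3)⁻¹) := by
  have hL3 : 0 ≤ L ^ 3 := by positivity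
  rw [← ENNReal.coe_pow, ENNReal.ofReal, ENNReal.coe_inj]
  ext
  rw [NNReal.coe_pow, coe_nnnorm, norm_inv, Complex.norm_real,
    Real.norm_of_nonneg (Real.sqrt_nonneg _), inv_pow, Real.sq_sqrt hL3,
    Real.coe_toNNReal _ (by positivity)]

/-- **The constant-mode occupation is a slice functional**: for an `(n+1)`-body Dirichlet trial
state in the box of side `L > 0`,
`⟨φ₀, γ_Ψ φ₀⟩ = (n+1) · L⁻³ · ∫ ‖∫ Ψ(x, Y) dx‖² dY`. [folklore] -/
theorem occupation_constMode_eq_slices (hL : 0 < L) (Ψ : TrialState (n + 1) L) :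
    occupation (n + 1) ((box L).indicator fun _ => ((Real.sqrt (L ^ 3))⁻¹ : ℂ)) Ψ.ψ =
      (n + 1 : ℝ≥0∞) * (ENNReal.ofReal ((L ^ 3)⁻¹) *
        ∫⁻ Y : Config n, (‖∫ x, Ψ.ψ (Matrix.vecCons x Y)‖₊ : ℝ≥0∞) ^ 2) := by
  change (n + 1 : ℝ≥0∞) * ∫⁻ Y : Config n,
      (‖∫ x, conj ((box L).indicator (fun _ => ((Real.sqrt (L ^ 3))⁻¹ : ℂ)) x) *
        Ψ.ψ (Matrix.vecCons x Y)‖₊ : ℝ≥0∞) ^ 2 = _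
  congr 1
  simp_rw [FlatModeFromLandscape.conj_flatMode_mul_slice, integral_const_mul, nnnorm_mul, ENNReal.coe_mul, mul_pow,
    nnnorm_constMode_sq hL]
  rw [lintegral_const_mul' _ _ ENNReal.ofReal_ne_top]

/-- **Slice delocalisation on a massive set of configurations bounds the constant-mode occupation
from below.** If on a measurable set `G` of configurations `Y` of the other `n` particles the slice
`u_Y = Ψ(·, Y)` satisfies `c · L³ ∫ |u_Y|² ≤ |∫ u_Y|²`, and these slices carry mass
`m ≤ ∫_G ∫ |u_Y|² dY`, then `(n+1) · c · m ≤ ⟨φ₀, γ_Ψ φ₀⟩`. [folklore] -/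
theorem mul_le_occupation_constMode_of_slices (hL : 0 < L) (Ψ : TrialState (n + 1) L)
    {c m : ℝ≥0∞} {G : Set (Config n)} (hG : MeasurableSet G)
    (hgood : ∀ Y ∈ G, c * ENNReal.ofReal (L ^ 3) *
      ∫⁻ x, (‖Ψ.ψ (Matrix.vecCons x Y)‖₊ : ℝ≥0∞) ^ 2 ≤
        (‖∫ x, Ψ.ψ (Matrix.vecCons x Y)‖₊ : ℝ≥0∞) ^ 2)
    (hmass : m ≤ ∫⁻ Y in G, ∫⁻ x, (‖Ψ.ψ (Matrix.vecCons x Y)‖₊ : ℝ≥0∞) ^ 2) :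
    (n + 1 : ℝ≥0∞) * (c * m) ≤
      occupation (n + 1) ((box L).indicator fun _ => ((Real.sqrt (L ^ 3))⁻¹ : ℂ)) Ψ.ψ := by
  rw [occupation_constMode_eq_slices hL Ψ]
  refine mul_le_mul' le_rfl ?_
  have hL3 : ENNReal.ofReal (L ^ 3) ≠ 0 := by positivity
  have hinv : ENNReal.ofReal ((L ^ 3)⁻¹) * ENNReal.ofReal (L ^ 3) = 1 := by
    rw [← ENNReal.ofReal_mul (by positivity), inv_mul_cancel₀ (by positivity), ENNReal.ofReal_one]
  calc c * m ≤ c * ∫⁻ Y in G, ∫⁻ x, (‖Ψ.ψ (Matrix.vecCons x Y)‖₊ : ℝ≥0∞) ^ 2 := by gcongr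
    _ = ENNReal.ofReal ((L ^ 3)⁻¹) * ((c * ENNReal.ofReal (L ^ 3)) *
          ∫⁻ Y in G, ∫⁻ x, (‖Ψ.ψ (Matrix.vecCons x Y)‖₊ : ℝ≥0∞) ^ 2) := by
        rw [← mul_assoc, ← mul_assoc, mul_comm (ENNReal.ofReal _) c, mul_assoc c, hinv, mul_one]
    _ ≤ ENNReal.ofReal ((L ^ 3)⁻¹) * ∫⁻ Y in G, c * ENNReal.ofReal (L ^ 3) *
          ∫⁻ x, (‖Ψ.ψ (Matrix.vecCons x Y)‖₊ : ℝ≥0∞) ^ 2 := by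
        exact mul_le_mul' le_rfl (lintegral_const_mul_le _ _)
    _ ≤ ENNReal.ofReal ((L ^ 3)⁻¹) *
          ∫⁻ Y in G, (‖∫ x, Ψ.ψ (Matrix.vecCons x Y)‖₊ : ℝ≥0∞) ^ 2 := by
        exact mul_le_mul' le_rfl (setLIntegral_mono' hG hgood)
    _ ≤ ENNReal.ofReal ((L ^ 3)⁻¹) *
          ∫⁻ Y, (‖∫ x, Ψ.ψ (Matrix.vecCons x Y)‖₊ : ℝ≥0∞) ^ 2 := by
        exact mul_le_mul' le_rfl (setLIntegral_le_lintegral _ _)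

/-- **Reduction of the item to mean slice delocalisation.** `HardSphereZeroMode` follows from (and,
by `occupation_constMode_eq_slices`, is a rephrasing of) the statement that for small reduced
density `η` and all large particle numbers `n+1`, every sufficiently-near minimiser `Ψ` of the
unit-hard-sphere Dirichlet energy in the box of side `L = ((n+1)/η)^{1/3}` has slices
`u_Y = Ψ(·, Y)` with `∫ ‖∫ u_Y(x) dx‖² dY ≥ c · L³` — the un-normalised form of
"`E_Y[(∫u_Y)² / (L³ ∫u_Y²)] ≥ c`" (the slices have total mass `1`). [folklore] -/
theorem hardSphereZeroMode_of_meanSliceDelocalisation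
    (h : ∃ η₁ : ℝ, 0 < η₁ ∧ ∀ η : ℝ, 0 < η → η < η₁ → ∃ c : ℝ, 0 < c ∧ ∀ᶠ n : ℕ in Filter.atTop,
      ∃ δ : ℝ≥0∞, 0 < δ ∧ ∀ Ψ : TrialState (n + 1) (sideLength η (n + 1)),
        energy (Set.indicator (Set.Iic 1) (fun _ : ℝ => (⊤ : ℝ≥0∞))) Ψ ≤
          groundStateEnergy (Set.indicator (Set.Iic 1) (fun _ : ℝ => (⊤ : ℝ≥0∞))) (n + 1)
            (sideLength η (n + 1)) + δ →
        ENNReal.ofReal c * ENNReal.ofReal (sideLength η (n + 1) ^ 3) ≤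
          ∫⁻ Y : Config n, (‖∫ x, Ψ.ψ (Matrix.vecCons x Y)‖₊ : ℝ≥0∞) ^ 2) :
    Summit.AtomisticToContinuum.BoseEinsteinCondensation.Theses.BECHardSphereReduction.HardSphereZeroMode := by
  obtain ⟨η₁, hη₁, h⟩ := h
  refine ⟨η₁, hη₁, fun η hη hηlt => ?_⟩
  obtain ⟨c, hc, hev⟩ := h η hη hηlt
  refine ⟨c, hc, ?_⟩
  rw [Filter.eventually_atTop] at hev ⊢
  obtain ⟨n₀, hn₀⟩ := hev
  refine ⟨n₀ + 1, fun N hN => ?_⟩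
  obtain ⟨n, rfl⟩ : ∃ n, N = n + 1 := ⟨N - 1, by omega⟩
  obtain ⟨δ, hδ, hΨ⟩ := hn₀ n (by omega)
  refine ⟨δ, hδ, fun Ψ hE => ?_⟩
  have hL : 0 < sideLength η (n + 1) :=
    Real.rpow_pos_of_pos (div_pos (Nat.cast_pos.mpr n.succ_pos) hη) _
  have hL3 : 0 < sideLength η (n + 1) ^ 3 := pow_pos hL 3
  have key : ENNReal.ofReal c ≤ ENNReal.ofReal ((sideLength η (n + 1) ^ 3)⁻¹) *
      ∫⁻ Y : Config n, (‖∫ x, Ψ.ψ (Matrix.vecCons x Y)‖₊ : ℝ≥0∞) ^ 2 := by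
    have h1 := hΨ Ψ hE
    calc ENNReal.ofReal c
        = ENNReal.ofReal ((sideLength η (n + 1) ^ 3)⁻¹) *
            (ENNReal.ofReal c * ENNReal.ofReal (sideLength η (n + 1) ^ 3)) := by
          rw [ENNReal.ofReal_inv_of_pos hL3, mul_comm (ENNReal.ofReal c), ← mul_assoc,
            ENNReal.inv_mul_cancel (by positivity) ENNReal.ofReal_ne_top, one_mul]
      _ ≤ _ := mul_le_mul' le_rfl h1
  rw [occupation_constMode_eq_slices hL Ψ]
  calc ENNReal.ofReal (c * ((n + 1 : ℕ) : ℝ)) = (n + 1 : ℝ≥0∞) * ENNReal.ofReal c := by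
        rw [ENNReal.ofReal_mul hc.le, ENNReal.ofReal_natCast, mul_comm]
        push_cast
        rfl
    _ ≤ _ := mul_le_mul' le_rfl key

/-- **Reduction of the item to slice delocalisation on good configurations.** If for small `η`
there are `c, m > 0` such that for all large `n+1` every sufficiently-near minimiser `Ψ` of the
unit-hard-sphere Dirichlet energy in the box of side `L = ((n+1)/η)^{1/3}` admits a measurable set
`G` of configurations `Y` of the other `n` particles on which the slice `u_Y = Ψ(·, Y)` is
delocalised, `c · L³ ∫|u_Y|² ≤ |∫ u_Y|²`, and which carries mass `∫_G ∫ |u_Y|² ≥ m`, then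
`HardSphereZeroMode` holds with constant `c · m`. [folklore] -/
theorem hardSphereZeroMode_of_goodConfigurations
    (h : ∃ η₁ : ℝ, 0 < η₁ ∧ ∀ η : ℝ, 0 < η → η < η₁ → ∃ c m : ℝ, 0 < c ∧ 0 < m ∧
      ∀ᶠ n : ℕ in Filter.atTop, ∃ δ : ℝ≥0∞, 0 < δ ∧
        ∀ Ψ : TrialState (n + 1) (sideLength η (n + 1)),
        energy (Set.indicator (Set.Iic 1) (fun _ : ℝ => (⊤ : ℝ≥0∞))) Ψ ≤
          groundStateEnergy (Set.indicator (Set.Iic 1) (fun _ : ℝ => (⊤ : ℝ≥0∞))) (n + 1)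
            (sideLength η (n + 1)) + δ →
        ∃ G : Set (Config n), MeasurableSet G ∧
          (∀ Y ∈ G, ENNReal.ofReal c * ENNReal.ofReal (sideLength η (n + 1) ^ 3) *
              ∫⁻ x, (‖Ψ.ψ (Matrix.vecCons x Y)‖₊ : ℝ≥0∞) ^ 2 ≤
            (‖∫ x, Ψ.ψ (Matrix.vecCons x Y)‖₊ : ℝ≥0∞) ^ 2) ∧
          ENNReal.ofReal m ≤ ∫⁻ Y in G, ∫⁻ x, (‖Ψ.ψ (Matrix.vecCons x Y)‖₊ : ℝ≥0∞) ^ 2) :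
    Summit.AtomisticToContinuum.BoseEinsteinCondensation.Theses.BECHardSphereReduction.HardSphereZeroMode := by
  obtain ⟨η₁, hη₁, h⟩ := h
  refine ⟨η₁, hη₁, fun η hη hηlt => ?_⟩
  obtain ⟨c, m, hc, hm, hev⟩ := h η hη hηlt
  refine ⟨c * m, mul_pos hc hm, ?_⟩
  rw [Filter.eventually_atTop] at hev ⊢
  obtain ⟨n₀, hn₀⟩ := hev
  refine ⟨n₀ + 1, fun N hN => ?_⟩
  obtain ⟨n, rfl⟩ : ∃ n, N = n + 1 := ⟨N - 1, by omega⟩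
  obtain ⟨δ, hδ, hΨ⟩ := hn₀ n (by omega)
  refine ⟨δ, hδ, fun Ψ hE => ?_⟩
  obtain ⟨G, hG, hgood, hmass⟩ := hΨ Ψ hE
  have hL : 0 < sideLength η (n + 1) :=
    Real.rpow_pos_of_pos (div_pos (Nat.cast_pos.mpr n.succ_pos) hη) _
  calc ENNReal.ofReal (c * m * ((n + 1 : ℕ) : ℝ))
      = (n + 1 : ℝ≥0∞) * (ENNReal.ofReal c * ENNReal.ofReal m) := by
        rw [ENNReal.ofReal_mul (mul_pos hc hm).le, ENNReal.ofReal_mul hc.le,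
          ENNReal.ofReal_natCast, mul_comm]
        push_cast
        rfl
    _ ≤ _ := mul_le_occupation_constMode_of_slices hL Ψ hG hgood hmass

end Summit.AtomisticToContinuum.BoseEinsteinCondensation.Theorems

end
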